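import Literature.NumberTheory.NumberFields.DiscriminantSquareRoot
import Mathlib.FieldTheory.Normal.Closure
import Mathlib.FieldTheory.IsAlgClosed.AlgebraicClosure
import Mathlib.FieldTheory.Galois.Basic
import Mathlib.NumberTheory.NumberField.Basic
import HarnessLib

/-!
# A cubic number field is Galois over `ℚ` iff its discriminant is a square; the Galois closure of a non-cyclic cubic is an `S₃`-sextic

Topic `NumberTheory/CubicFields`; namespace `Literature.NumberTheory.CubicFields`. Theorem-only file (no definition, no named fact, no `sorry`),
written by the prover seat `bsd-line-att-p4` g33 (cell `bsd-f1-sign2`, `--supports` stmt-BirchSwinnertonDyer-22298; closes nothing there). Companion of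
`CubicResolventClosure.lean` (the `S₃`-closure in discriminant currency `d_K = d_k f²`) and of `NumberFields/DiscriminantSquareRoot.lean` (`√d_F` inside a
normal closure and the Galois action on it). Classical statement (Cohen GTM 138 §6.3.3; Marcus, Number Fields Ch. 2; Milne FT Ch. 4: the Galois group of an
irreducible cubic is `A₃` or `S₃` according as the discriminant is or is not a square):

* `exists_galoisClosure_of_not_isGalois_cubic` — for a cubic number field `F` NOT Galois over `ℚ` there is `N ⊆ ℚ̄`, Galois over `ℚ` of degree `6`,
  receiving `F` and generated by the conjugates of `F` (the normal closure; degree: `3 ∣ [N:ℚ] ≤ 3! = 6` by the faithful permutation representation on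
  the three embeddings, `≠ 3` since `F` is not Galois);
* ★ `not_isSquare_discr_of_not_isGalois_cubic` — **`F` cubic, not Galois ⟹ `d_F` is not a square** (`√d_F ∈ N` is moved by a transposition);
* ★ `isSquare_discr_of_isGalois_cubic` — **`F` cubic Galois ⟹ `d_F` is a square** (`√d_F ∈ F^{Gal} = ℚ`, the group having odd order `3`);
* ★★ `isGalois_iff_isSquare_discr_cubic` — **a cubic number field is Galois over `ℚ` iff its discriminant is a square in `ℤ`**.

## References

* H. Cohen, *A Course in Computational Algebraic Number Theory*, GTM 138, §6.3.3. [Cohen1993]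
* D. A. Marcus, *Number Fields*, 2nd ed., Ch. 2 (discriminants and embeddings). [Marcus2018]
* J. S. Milne, *Fields and Galois Theory*, Ch. 4 (Galois groups of cubics). [MilneFT2022]
-/

noncomputable section

open NumberField Module IntermediateField

namespace Literature.NumberTheory.CubicFields

open Literature.NumberTheory.NumberFields

/-- **The Galois closure of a non-cyclic cubic field is a sextic.**  For a cubic number field `F` not Galois over `ℚ` there is `N ⊆ ℚ̄`, Galois of
degree `6` over `ℚ`, with an embedding `ι : F →ₐ[ℚ] N`, such that the conjugates of `F` generate `N` and all three embeddings `F → ℚ̄` land in `N`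
(the normal closure of `F` in `ℚ̄`). Degree count: `3 ∣ [N:ℚ]`; the permutation representation of `Gal(N/ℚ)` on the three embeddings is faithful, so
`[N:ℚ] ≤ 6`; and `[N:ℚ] ≠ 3` because `F ≅ ι(F) ≠ N` is not Galois. [cite: MilneFT2022, Ch. 4 (Galois group of a cubic)] [cite: Marcus2018, Ch. 2] -/
theorem exists_galoisClosure_of_not_isGalois_cubic (F : Type) [Field F] [NumberField F] (hF : finrank ℚ F = 3) (hFG : ¬ IsGalois ℚ F) :
    ∃ N : IntermediateField ℚ (AlgebraicClosure ℚ), ∃ _ : FiniteDimensional ℚ ↥N, IsGalois ℚ ↥N ∧ finrank ℚ ↥N = 6 ∧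
      Nonempty (F →ₐ[ℚ] ↥N) ∧ (⨆ σ : F →ₐ[ℚ] ↥N, σ.fieldRange) = ⊤ ∧ Fintype.card (F →ₐ[ℚ] ↥N) = 3 := by
  classical
  set Ω := AlgebraicClosure ℚ with hΩ
  haveI : Normal ℚ Ω := @IsAlgClosure.normal ℚ Ω _ _ (AlgebraicClosure.instAlgebra ℚ) inferInstance
  set ι₀ : F →ₐ[ℚ] Ω := IsAlgClosed.lift with hι₀
  haveI : Nonempty (F →ₐ[ℚ] Ω) := ⟨ι₀⟩
  set N : IntermediateField ℚ Ω := normalClosure ℚ F Ω with hNdef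
  haveI : FiniteDimensional ℚ N := normalClosure.is_finiteDimensional ℚ F Ω
  haveI : Normal ℚ N := normalClosure.normal ℚ F Ω
  haveI : Algebra.IsSeparable ℚ N := Algebra.IsAlgebraic.isSeparable_of_perfectField
  haveI : IsGalois ℚ N := IsGalois.mk
  set ι : F →ₐ[ℚ] N := (normalClosure.algHomEquiv ℚ F Ω).symm ι₀ with hιdef
  have hcard : Fintype.card (F →ₐ[ℚ] N) = finrank ℚ F :=
    (Fintype.card_congr (normalClosure.algHomEquiv ℚ F Ω)).trans (AlgHom.card ℚ F Ω)
  have hgen : (⨆ σ : F →ₐ[ℚ] N, σ.fieldRange) = ⊤ := by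
    have h := (Algebra.IsAlgebraic.isNormalClosure_iff.mp (isNormalClosure_normalClosure ℚ F Ω)).2
    rwa [normalClosure_def] at h
  -- degrees
  have hKF : finrank ℚ ι.fieldRange = 3 := by
    rw [← hF]; exact (LinearEquiv.finrank_eq (AlgEquiv.ofInjectiveField ι).toLinearEquiv).symm
  have h3dvd : 3 ∣ finrank ℚ N := ⟨finrank ι.fieldRange N, by rw [← hKF, Module.finrank_mul_finrank]⟩
  have hle6 : finrank ℚ N ≤ 6 := by
    obtain ⟨-, ρ, -, hρ, -⟩ := exists_perm_hom_det_sq_eq_discr F N hcard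
    have hρinj : Function.Injective ρ := by
      rw [← MonoidHom.ker_eq_bot_iff, Subgroup.eq_bot_iff_forall]
      intro τ hτ
      rw [MonoidHom.mem_ker] at hτ
      refine algEquiv_eq_one_of_forall_comp_eq hgen fun σ => ?_
      have := congrArg (fun π => π σ) hτ
      simpa [hρ] using this
    calc finrank ℚ N = Nat.card (N ≃ₐ[ℚ] N) := (IsGalois.card_aut_eq_finrank ℚ N).symm
      _ ≤ Nat.card (Equiv.Perm (F →ₐ[ℚ] N)) := Nat.card_le_card_of_injective ρ hρinj
      _ = 6 := by
          rw [Nat.card_eq_fintype_card, Fintype.card_perm, hcard, hF]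
          rfl
  -- `[N:ℚ] ≠ 3`: otherwise `ι(F) = N` would be Galois
  have hne3 : finrank ℚ N ≠ 3 := by
    intro h3
    have htop : ι.fieldRange = ⊤ :=
      IntermediateField.eq_of_le_of_finrank_eq le_top (by rw [hKF, IntermediateField.finrank_top', h3])
    have e : F ≃ₐ[ℚ] N := (AlgEquiv.ofInjectiveField ι).trans ((IntermediateField.equivOfEq htop).trans IntermediateField.topEquiv)
    exact hFG (IsGalois.of_algEquiv e.symm)
  have hpos : 0 < finrank ℚ N := finrank_pos
  have h6 : finrank ℚ N = 6 := by
    obtain ⟨c, hc⟩ := h3dvd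
    have hc2 : c ≤ 2 := by omega
    interval_cases c <;> omega
  exact ⟨N, inferInstance, inferInstance, h6, ⟨ι⟩, hgen, by rw [hcard, hF]⟩

/-- ★ **A cubic number field which is NOT Galois over `ℚ` has non-square discriminant**: in the sextic Galois closure `N`, `δ = det(σⱼ(xᵢ))` has
`δ² = d_F` and is MOVED by some automorphism (the faithful permutation representation on the three embeddings has image of order `6 > 3 = #A₃`), so
`δ ∉ ℚ` and `d_F` is not the square of an integer. [cite: Marcus2018, Ch. 2 (discriminants and embeddings)] [cite: Cohen1993, §6.3.3] -/
theorem not_isSquare_discr_of_not_isGalois_cubic (F : Type) [Field F] [NumberField F] (hF : finrank ℚ F = 3) (hFG : ¬ IsGalois ℚ F) :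
    ¬ IsSquare (discr F) := by
  classical
  obtain ⟨N, _, hGal, h6, ⟨ι⟩, hgen, hcard⟩ := exists_galoisClosure_of_not_isGalois_cubic F hF hFG
  haveI := hGal
  have hG : Nat.card (↥N ≃ₐ[ℚ] ↥N) = 6 := by rw [IsGalois.card_aut_eq_finrank, h6]
  obtain ⟨δ, -, hδsq, hδQ⟩ := exists_sq_eq_discr_mem_fixedField_not_mem_range F ↥N (by rw [hcard, hF]) (by rw [hF]; norm_num)
    hgen (by rw [hF, hG]; decide) ⊥ (by rw [Subgroup.card_bot]; exact ⟨0, rfl⟩)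
  rintro ⟨r, hr⟩
  have h : δ ^ 2 = ((r : ℤ) : ↥N) ^ 2 := by rw [hδsq, hr]; push_cast; ring
  rcases sq_eq_sq_iff_eq_or_eq_neg.mp h with h1 | h1
  · exact hδQ ⟨r, by rw [h1]; simp⟩
  · exact hδQ ⟨-r, by rw [h1]; simp⟩

/-- ★ **A cubic number field which IS Galois over `ℚ` has square discriminant**: `Gal(F/ℚ)` has odd order `3`, so `√d_F = det(σⱼ(xᵢ))` (all three
embeddings being automorphisms) is fixed by the whole group, i.e. rational; an integer which is a rational square is a square.
[cite: Marcus2018, Ch. 2 (discriminants and embeddings)] [cite: Cohen1993, §6.3.3] -/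
theorem isSquare_discr_of_isGalois_cubic (F : Type) [Field F] [NumberField F] (hF : finrank ℚ F = 3) [IsGalois ℚ F] :
    IsSquare (discr F) := by
  classical
  have hcard : Fintype.card (F →ₐ[ℚ] F) = finrank ℚ F := by
    rw [← Nat.card_eq_fintype_card, ← Nat.card_congr (algEquivEquivAlgHom ℚ F).toEquiv, IsGalois.card_aut_eq_finrank]
  have hodd : Odd (Nat.card (⊤ : Subgroup (F ≃ₐ[ℚ] F))) := by
    rw [Subgroup.card_top, IsGalois.card_aut_eq_finrank, hF]
    exact ⟨1, rfl⟩
  obtain ⟨δ, hδmem, -, hδsq⟩ := exists_sq_eq_discr_mem_fixedField F F hcard ⊤ hodd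
  rw [IsGalois.fixedField_top, IntermediateField.mem_bot] at hδmem
  obtain ⟨q, rfl⟩ := hδmem
  have hq : (q : ℚ) * q = (discr F : ℚ) := by
    apply (algebraMap ℚ F).injective
    rw [map_mul, ← sq, hδsq]
    simp
  have hQ : IsSquare ((discr F : ℤ) : ℚ) := ⟨q, hq.symm⟩
  exact Rat.isSquare_intCast_iff.mp hQ

/-- ★★ **A CUBIC NUMBER FIELD IS GALOIS OVER `ℚ` IFF ITS DISCRIMINANT IS A SQUARE** (cyclic cubics `A₃` vs `S₃`-cubics).
[cite: Cohen1993, §6.3.3] [cite: MilneFT2022, Ch. 4 (Galois group of a cubic: A₃ iff the discriminant is a square)] [cite: Marcus2018, Ch. 2] -/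
theorem isGalois_iff_isSquare_discr_cubic (F : Type) [Field F] [NumberField F] (hF : finrank ℚ F = 3) :
    IsGalois ℚ F ↔ IsSquare (discr F) :=
  ⟨fun _ ↦ isSquare_discr_of_isGalois_cubic F hF, fun h ↦ by_contra fun hFG ↦ not_isSquare_discr_of_not_isGalois_cubic F hF hFG h⟩

end Literature.NumberTheory.CubicFields

end
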